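import Literature.Geometry.Riemannian.IsotropicCurvature
import Literature.Geometry.Lorentzian.Curvature
import HarnessLib

/-!
# Metrics of constant sectional curvature
(topic `Geometry/Riemannian`)

The notion in which the conclusion of Hamilton's convergence theorems is stated (Hamilton 1982,
Thm. 1.1; **Hamilton 1986**, J. Differential Geom. 24, p. 154: "for … a compact four-manifold with
positive curvature operator, the solution exists for all time `t` and converges as `t → ∞` to a
metric of constant Riemannian curvature") and the hypothesis of the Killing–Hopf theorem (Lee,
*Riemannian Manifolds*, 2nd ed., Thm. 12.4, Cor. 12.5) — the two inputs into which Hamilton's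
Thm. 1.1 (`Literature.Geometry.Riemannian.hamilton_positiveCurvatureOperator_classification_four`,
`HamiltonPCOClassification.lean`) factors (`HamiltonPCOClassificationProofs.lean`). Over the tree's
`PseudoRiemannianMetric` / `curvatureForm` (`Rm(X,Y,Z,W) = g(R(X,Y)Z, W)`, Lee's sign,
`IsotropicCurvature.lean`):

* `PseudoRiemannianMetric.HasConstantSectionalCurvatureWith g cov c` — Lee, Prop. 8.36: "A
  Riemannian metric `g` has constant sectional curvature `c` if and only if …
  `R(v, w)x = c(⟨w, x⟩v - ⟨v, x⟩w)`", i.e. `Rm(X, Y, Z, W) = c (g(Y,Z) g(X,W) - g(X,Z) g(Y,W))` at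
  every point, for the pair `(g, cov)`;
* `PseudoRiemannianMetric.HasConstantSectionalCurvature g c` — the same for every Levi-Civita
  connection `cov` of `g` (the hypothesis-free phrasing of `HasPositiveIsotropicCurvature`,
  `HasPositiveCurvatureOperator`);
* API (proved): the sectional curvature of every orthonormal pair is `c`
  (`sectionalCurvature_eq`), `Rm(X,Y,Y,X) = c (g(X,X) g(Y,Y) - g(X,Y)²)` (`curvatureForm_pair`),
  the isotropic curvature of every orthonormal 4-frame is `4c` (`isotropicCurvature_eq`), hence
  constant curvature `c > 0` implies positive isotropic curvature
  (`hasPositiveIsotropicCurvatureWith`), and a flat connection has constant curvature `0`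
  (`hasConstantSectionalCurvatureWith_zero_of_isFlat`).

These are *definitions* (predicates with explicit binders `g`, `cov`, `c`), not assertions: there is
no `HasConstantSectionalCurvature_holds` (a flat connection has constant curvature `0` and not `1`).

## References

* J. M. Lee, *Introduction to Riemannian Manifolds*, 2nd ed. (2018), Ch. 8, Prop. 8.36 (constant
  sectional curvature `c`: `R(v,w)x = c(⟨w,x⟩v - ⟨v,x⟩w)`, `R_{ijkl} = c(g_{il}g_{jk} - g_{ik}g_{jl})`),
  Thm. 8.34 (the model spaces); Ch. 12, Thm. 12.4 (Killing–Hopf). [Lee2018]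
* R. S. Hamilton, *Four-manifolds with positive curvature operator*, J. Differential Geom. 24
  (1986) 153–179, p. 154. [Hamilton1986]
-/

noncomputable section

open Bundle
open scoped Manifold ContDiff Topology

namespace Literature.Geometry.Riemannian

variable {E : Type*} [NormedAddCommGroup E] [NormedSpace ℝ E] {H : Type*} [TopologicalSpace H]
  {I : ModelWithCorners ℝ E H} {M : Type*} [TopologicalSpace M] [ChartedSpace H M]
  [IsManifold I ∞ M] {n : ℕ∞ω}

section PseudoRiemannianMetric
open Literature.Geometry.Lorentzian (PseudoRiemannianMetric)
open Literature.Geometry.Lorentzian.PseudoRiemannianMetric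

variable (g : PseudoRiemannianMetric I n E (TangentSpace I : M → Type _))
  (cov : CovariantDerivative I E (TangentSpace I : M → Type _))

/-! ### Constant sectional curvature -/

/-- **Constant sectional curvature `c` for the pair `(g, cov)`** (Lee, *Riemannian Manifolds*,
2nd ed., Prop. 8.36: `g` has constant sectional curvature `c` iff
`R(v, w)x = c(⟨w, x⟩v - ⟨v, x⟩w)`, i.e. `R_{ijkl} = c(g_{il}g_{jk} - g_{ik}g_{jl})`): at every point
`x` and for all `X Y Z W ∈ T_x M`,
`Rm(X, Y, Z, W) = g(R(X,Y)Z, W) = c (g(Y,Z) g(X,W) - g(X,Z) g(Y,W))` (`curvatureForm`, Lee's sign,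
for which the round unit sphere has `c = 1`, Thm. 8.34). Intended for `cov` a Levi-Civita
connection of a Riemannian `g`. A predicate on `(g, cov, c)` (explicit binders), not an assertion.
[cite: Lee2018, Prop. 8.36] -/
def _root_.Literature.Geometry.Lorentzian.PseudoRiemannianMetric.HasConstantSectionalCurvatureWith
    (c : ℝ) : Prop :=
  ∀ (x : M) (X Y Z W : TangentSpace I x),
    g.curvatureForm cov x X Y Z W = c * (g.val x Y Z * g.val x X W - g.val x X Z * g.val x Y W)

/-- **Constant sectional curvature `c`** of the metric `g` itself (Lee, *Riemannian Manifolds*,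
2nd ed., Prop. 8.36; the "metric of constant Riemannian curvature" of Hamilton 1986, p. 154): for
every covariant derivative `cov` on `TM` which is a Levi-Civita connection of `g`
(`PseudoRiemannianMetric.IsLeviCivita`; it exists and is unique for `C¹` metrics,
`LeviCivita.lean`), `(g, cov)` has constant sectional curvature `c`. Same hypothesis-free phrasing
as `HasPositiveIsotropicCurvature` and `HasPositiveCurvatureOperator`. A predicate (explicit
binders `g`, `c`), not an assertion. [cite: Lee2018, Prop. 8.36] [cite: Hamilton1986, §1, p. 154] -/
def _root_.Literature.Geometry.Lorentzian.PseudoRiemannianMetric.HasConstantSectionalCurvature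
    [FiniteDimensional ℝ E] [CompleteSpace E] (c : ℝ) : Prop :=
  ∀ cov : CovariantDerivative I E (TangentSpace I : M → Type _), g.IsLeviCivita cov →
    g.HasConstantSectionalCurvatureWith cov c

variable {g cov} {c : ℝ}

/-- Specialising to a Levi-Civita connection. [folklore] -/
theorem _root_.Literature.Geometry.Lorentzian.PseudoRiemannianMetric.HasConstantSectionalCurvature.with
    [FiniteDimensional ℝ E] [CompleteSpace E] (h : g.HasConstantSectionalCurvature c)
    (hcov : g.IsLeviCivita cov) : g.HasConstantSectionalCurvatureWith cov c :=
  h cov hcov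

/-- Unfolding: `Rm(X, Y, Z, W) = c (g(Y,Z) g(X,W) - g(X,Z) g(Y,W))`. [cite: Lee2018, Prop. 8.36] -/
theorem _root_.Literature.Geometry.Lorentzian.PseudoRiemannianMetric.HasConstantSectionalCurvatureWith.curvatureForm_eq
    (h : g.HasConstantSectionalCurvatureWith cov c) (x : M) (X Y Z W : TangentSpace I x) :
    g.curvatureForm cov x X Y Z W =
      c * (g.val x Y Z * g.val x X W - g.val x X Z * g.val x Y W) :=
  h x X Y Z W

/-- On a pair: `Rm(X, Y, Y, X) = c (g(X,X) g(Y,Y) - g(X,Y)²)`, the numerator of the sectional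
curvature times `c`. [cite: Lee2018, Prop. 8.36] -/
theorem _root_.Literature.Geometry.Lorentzian.PseudoRiemannianMetric.HasConstantSectionalCurvatureWith.curvatureForm_pair
    (h : g.HasConstantSectionalCurvatureWith cov c) (x : M) (X Y : TangentSpace I x) :
    g.curvatureForm cov x X Y Y X = c * (g.val x X X * g.val x Y Y - g.val x X Y ^ 2) := by
  rw [h.curvatureForm_eq, g.symm x Y X]
  ring

/-- **Every nondegenerate plane has sectional curvature `c`**: if `(g, cov)` has constant sectional
curvature `c` then `K(X, Y) = c` whenever `g(X,X) g(Y,Y) - g(X,Y)² ≠ 0` (Lee, Prop. 8.36, the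
"only if" direction being the definition of the words). [cite: Lee2018, Prop. 8.36] -/
theorem _root_.Literature.Geometry.Lorentzian.PseudoRiemannianMetric.HasConstantSectionalCurvatureWith.sectionalCurvature_eq
    (h : g.HasConstantSectionalCurvatureWith cov c) (x : M) {X Y : TangentSpace I x}
    (hXY : g.val x X X * g.val x Y Y - g.val x X Y ^ 2 ≠ 0) :
    g.sectionalCurvature cov x X Y = c := by
  rw [sectionalCurvature, h.curvatureForm_pair, mul_div_assoc, div_self hXY, mul_one]

/-- In particular `K(X, Y) = c` for every `g`-orthonormal pair. [cite: Lee2018, Prop. 8.36] -/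
theorem _root_.Literature.Geometry.Lorentzian.PseudoRiemannianMetric.HasConstantSectionalCurvatureWith.sectionalCurvature_eq_of_orthonormal
    (h : g.HasConstantSectionalCurvatureWith cov c) (x : M) {X Y : TangentSpace I x}
    (hX : g.val x X X = 1) (hY : g.val x Y Y = 1) (hXY : g.val x X Y = 0) :
    g.sectionalCurvature cov x X Y = c :=
  h.sectionalCurvature_eq x (by rw [hX, hY, hXY]; norm_num)

/-- **The isotropic curvature of a constant-curvature pair is `4c` on every orthonormal 4-frame**:
each of the four sectional terms `Rm(eᵢ, eⱼ, eⱼ, eᵢ)` is `c` and `R₁₂₄₃ = 0`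
(`isotropicCurvature`, Micallef–Moore's expression `K₁₃ + K₁₄ + K₂₃ + K₂₄ - 2R₁₂₃₄`). [folklore] -/
theorem _root_.Literature.Geometry.Lorentzian.PseudoRiemannianMetric.HasConstantSectionalCurvatureWith.isotropicCurvature_eq
    (h : g.HasConstantSectionalCurvatureWith cov c) (x : M) {e : Fin 4 → TangentSpace I x}
    (he : g.IsOrthonormalFrame x e) : g.isotropicCurvature cov x e = 4 * c := by
  simp only [isotropicCurvature, h.curvatureForm_eq, he.1, he.2 0 2 (by decide),
    he.2 0 3 (by decide), he.2 1 2 (by decide), he.2 1 3 (by decide),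
    he.2 2 0 (by decide), he.2 3 0 (by decide), he.2 2 1 (by decide), he.2 3 1 (by decide)]
  ring

/-- **Constant positive sectional curvature implies positive isotropic curvature** (for the pair
`(g, cov)`): the isotropic curvature of every orthonormal 4-frame is `4c > 0` (Micallef–Moore
1988, §1: the round sphere is the model PIC manifold). [folklore] -/
theorem _root_.Literature.Geometry.Lorentzian.PseudoRiemannianMetric.HasConstantSectionalCurvatureWith.hasPositiveIsotropicCurvatureWith
    (h : g.HasConstantSectionalCurvatureWith cov c) (hc : 0 < c) :
    g.HasPositiveIsotropicCurvatureWith cov := by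
  intro x e he
  rw [h.isotropicCurvature_eq x he]
  positivity

/-- Hence a metric of constant sectional curvature `c > 0` has positive isotropic curvature.
[folklore] -/
theorem _root_.Literature.Geometry.Lorentzian.PseudoRiemannianMetric.HasConstantSectionalCurvature.hasPositiveIsotropicCurvature
    [FiniteDimensional ℝ E] [CompleteSpace E] (h : g.HasConstantSectionalCurvature c)
    (hc : 0 < c) : g.HasPositiveIsotropicCurvature :=
  fun _ hcov ↦ (h.with hcov).hasPositiveIsotropicCurvatureWith hc

/-- **A flat connection has constant sectional curvature `0`** (`R = 0`; Lee, Thm. 8.34 (a): Euclidean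
space has constant sectional curvature `0`) — in particular the predicate is a genuine condition
relating `(g, cov)` and `c`, with no `_holds` form. [cite: Lee2018, Thm. 8.34 (a)] -/
theorem hasConstantSectionalCurvatureWith_zero_of_isFlat (hflat : cov.IsFlat) :
    g.HasConstantSectionalCurvatureWith cov 0 := by
  intro x X Y Z W
  rw [curvatureForm, (cov.isFlat_iff).1 hflat x X Y Z]
  simp

end PseudoRiemannianMetric

end Literature.Geometry.Riemannian

end
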